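import Literature.MathematicalPhysics.QuantumFieldTheory.Balaban1983to89.T4WindowLevelShift

/-!
# T⁴ programme, node U5b/U5.E — FROM THE FINEST LEVEL TO THE WINDOW: the two runs of the η-design presented on ONE
# `K`-free window space from their finest-level term representations (the SOCKET of owed item (o1) of record
# `t4/T4-EST-U5bE2.md` §19.5, made kernel; cell `pub-balaban`, estimate row T4-U5b.E2, lineage pv07, journal self-row
# T4-U5b.E2-ETA-FINESTWINDOW°; version tag v1 (2026-08-19); LOW LEAF: imports `T4WindowLevelShift` v1 only (through it
# `T4AveragingDisintegration` v1.3, `T4LevelShift`, `T4LipschitzLedger`); ADDITIVE — no existing module is modified)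

HONEST FRAMING.  This module is KERNEL BOOKKEEPING (Radon–Nikodym / Fubini / reindexing) for the cell's η-design: the two runs
`K_A = K`, `K_B = K + 1` of Bałaban's renormalization group on one four-torus, compared term by term on ONE window probability space
(`T4AveragingDisintegration` §6/§7, `T4WindowLevelShift`).  It proves NO estimate of [Balaban1988RG2] / [Balaban1989LargeFieldII],
quotes NO sentence of Bałaban's series, carries NO cite tag, and asserts nothing printed: every declaration is a statement about the
tree's own typed objects (`Setup.Params`/`PBond`/`GaugeField`/`fieldMeasure`, `T4Continuum.T4Family`, `BlockAveraging.avgFun`,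
`ExpMeanLog.expMeanLogSU`, `T4LevelShift.bondShift`/`fieldShift`, `T4AveragingDisintegration.relabel`/`towerMap`/`perfDensity`,
`T4LipschitzLedger.TermRepr`/`cauchy_of_repr`) and is tagged [folklore].  NOT summit progress; rung (B)+1 bookkeeping on one
four-torus; NOT infinite volume, NOT a mass gap, NOT the Clay problem.

## Why (the socket half of owed item (o1) of the η-design)

The U5 referee's ruling (`t4/T4-REF-U5.md` §13.1, folding this lineage's answer R-Ω-1) types a printed term `τ`'s two-run comparison
space as THE WINDOW: `Ω_W(τ) := GaugeField P_W 0 G`, `μ_W := fieldMeasure P_W 0 G` with the window record `P_W := window P N_W(τ)`,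
BOTH `K`-INDEPENDENT; both runs' `TermRepr` typed on `(Ω_W, μ_W)` DIRECTLY; everything OLDER than the window PERFORMED, i.e. entering
as a VALUE `ρ^{old,X}_τ` = the Radon–Nikodym density with respect to `μ_W` of the image, under run `X`'s old tower map (`K − N_W`
resp. `K + 1 − N_W` exact averaging steps, then the relabelling), of run `X`'s weighted finest-level Haar measure; with the standing
precisions P-1′ (the window depth `N_W(τ)` is `K`-free — load-bearing for the TYPE), P-2 (admissibility of the undeclared young
factors), P-3.  The tree has every piece as a GENERIC constructor: `termRepr_performed` (§6b), `towerMap`/`towerAC_expMeanLogSU_SUN`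
(§6c), `termRepr_window_SUN_relabel` (§7) with an ABSTRACT relabelling `ε K τ : PBond (PW K τ) (jW K τ) ≃ PBond (Pf K τ) (lvl K τ +
k K τ)` demanded for EVERY `K, τ`, and `T4WindowLevelShift` identifies `window (F.P K) N_W = F.P N_W`, `windowBondEquiv = bondShift`
and proves the block-map bookkeeping (o6).  What NO tree theorem does is the INSTANTIATION in the cell's family `T4Family` on `SU(N)`:
(i) a total relabelling `PBond (F.P N_W(τ)) 0 ≃ PBond (F.P K) (K − N_W(τ))` does not exist for `K < N_W(τ)` (different
cardinalities), so `termRepr_window_SUN_relabel` cannot be fed a `K`-free window depth as typed — the absolute continuity of §6b must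
be asked only where terms live (`τ ∈ T K`, where `N_W(τ) ≤ K`); (ii) the two runs must land on the SAME reference family with
LITERAL cutoffs `K` and `K + 1` (the shape of `cauchy_of_repr`'s `hZB : Z (K+1) t = Σ_{τ ∈ T K} B K t τ`); the `K`-dependent
window levels `jW K τ := N_W − K_X` considered on the record make the window TYPE `K`-dependent (P-1′ violated) — see DIVERGENCE (b).
This leaf supplies exactly that instantiation, END-TO-END into `T4LipschitzLedger.cauchy_of_repr`.

## What this file adds (and only this)

§1 `perfDensity_mul_comp_ae` — TAKING OUT WHAT LIVES ON THE WINDOW: a bounded measurable nonnegative factor `g ∘ Tr` of the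
   weight passes through the performed density as the factor `g`, a.e. (the referee's factorisation `R^X_τ = [undeclared young
   factors] × ρ^{old,X}_τ` of §13.1 as an a.e. identity; P-2's objects stay visible); `termRepr_performed_mem` — §6b's performed
   step with measurability and absolute continuity of the transport demanded ONLY for `τ ∈ T K`; `termRepr_congr_vars` — a
   `TermRepr` is unchanged under pointwise-equal tested variables (the slot factor reads `u i` only).
§2 THE OLD TRANSPORT of the run with cutoff `K'` to the window of depth `N_W`, for ANY small-loop average `ℰ` on any group:
   `oldTr F ℰ K' N_W := relabel (bondShift (oldModulus F h 0)) ∘ towerMap (avgFun ℰ) 0 (K' − N_W)` when `h : N_W ≤ K'` (and the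
   constant configuration `1` in the regime `K' < N_W`, which no term occupies) : `GaugeField (F.P K') 0 G → GaugeField (F.P N_W) 0 G`;
   `oldTr_of_le`/`oldTr_apply`, `oldTr_self` (no old steps: `oldTr F ℰ K' K' = id`), `measurable_oldTr`; on `SU(N)` with Bałaban's
   exp-mean-log averaging `oldTr_haarAC_SUN` (product Haar ↦ ≪ product Haar: `towerAC_expMeanLogSU_SUN` + `relabel_haarAC` BY NAME);
   the OLD DENSITY `oldDensity F ℰ K' N_W Fw := perfDensity (Haar_{K',0}) Fw (oldTr …) (Haar_{N_W,0})` = `ρ^{old,X}_τ` as a VALUE on the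
   window, `integral_oldDensity_mul` (its push-forward identity), `integral_oldDensity` (mass), `oldDensity_mul_comp_ae`.
§3 THE SOCKET THEOREM `termRepr_window_of_finest`: for a cutoff family `KX : ℕ → ℕ` (run A: `K`, run B: `K + 1`) and a `K`-FREE
   window depth `NW : ι → ℕ` with `∀ K, ∀ τ ∈ T K, NW τ ≤ KX K`, a finest-level `TermRepr` against `fieldMeasure (F.P (KX K)) 0 (SU N)`
   whose tested variables are window variables `uX K τ i : GaugeField (F.P (NW τ)) 0 (SU N) → ℝ` composed with `oldTr` IS a window
   `TermRepr` against the ONE reference family `fun _ τ ↦ fieldMeasure (F.P (NW τ)) 0 (SU N)` with remainder `oldDensity … (FX K t τ)`;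
   named runs `termRepr_window_of_finest_A` (`KX K = K`) / `_B` (`KX K = K + 1`); `termRepr_window_of_finest_of_eq` (the same from
   a representation with ANY finest-level tested functionals agreeing pointwise with the window variables along `oldTr`, via §1's
   `termRepr_congr_vars`); `meas_comp_oldTr` (the finest-level `meas` field from window measurability).  The window's type family
   `fun _ τ ↦ GaugeField (F.P (NW τ)) 0 (SU N)` and its reference take NO cutoff argument — the half of P-1′ that `cauchy_of_repr`
   needs (ONE space family for both runs) holds BY CONSTRUCTION; the quantitative half of P-1′ (`NW τ ≤ N` uniformly, which keeps the
   window lattice `K`-uniform through the term index) is the supplier's, untouched here.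
§4 RECOGNITION OF THE YOUNG SLOT VARIABLES (the (o1) supplier's rewriting lemmas): `towerMap_oldTr` (the window's `k₂`-fold averages
   of `oldTr U` are run `K'`'s own `(K' − N_W + k₂)`-fold averages of `U`, relabelled — `T4WindowLevelShift.towerMap_relabel_towerMap`
   BY NAME), `young_slot_eq`, and the AGE form `young_slot_eq_age`: a slot variable of age `a ≤ N_W`, typed on the window as a
   functional `f` of the `(N_W − a)`-fold window average, equals along `oldTr` the same `f` of run `K'`'s OWN `(K' − a)`-fold average
   of its finest field read through the level identification `fieldShift (youngModulus F h ha)` (same-run index transport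
   `towerMap_fieldShift_of_eq` along `K' − N_W + (N_W − a) = K' − a`).
§5 END-TO-END `cauchy_of_finest`: `T4LipschitzLedger.cauchy_of_repr` with its two `TermRepr` binders `hA`/`hB` REPLACED by the two
   finest-level representations — run A against `fieldMeasure (F.P K) 0 (SU N)`, run B against `fieldMeasure (F.P (K + 1)) 0 (SU N)`,
   both discharged onto the common window family by §3 —, every other binder verbatim on the window reference with the remainders
   `oldDensity F EML K (NW τ) (FA K t τ)` / `oldDensity F EML (K + 1) (NW τ) (FB K t τ)`.
§6 SANITY on `T4WindowLevelShift.Sanity.F13` (`L = 13`, `m = 1`): the transport, the recognition identities and `oldTr_self` fire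
   with numerals.

WHAT IS NOT PROVED / VALUE.  Nothing analytic.  OWED after this leaf, unchanged in substance: the finest-level representations
themselves (node U5d/U0 typing of the printed (2.18) terms — the index type `ι`, `T K` with the window depths `NW τ ≤ N`, arities,
slot ages / copies / polarities / thresholds, the window functionals `uA`, `uB` of the young slot variables, and the finest-level
weights `FA`, `FB`: actions, old characteristic functions, P-2-admissible undeclared young factors, the source factor), the closeness
`SupClose` (o3), the per-run `ShellWeightBound` inputs (o4) and node U5b's two-run factor ledger `hsw` on `oldDensity B / oldDensity A`
(+ question Q-η-3).  VALUE = their exact TYPES are now fixed by `cauchy_of_finest`'s binder list, and the finest-level → window step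
(performed old integrations, `HaarAC` along the old chain, the relabelling, the `K`-free window, literal cutoffs `K`/`K + 1`) is
discharged once and for all in the family `T4Family` on `SU(N)`.

DIVERGENCE (cell row D-pv07.25).  (a) The renormalization transformations act ONE AT A TIME (the tree's `Setup.IsRT` types one
transformation `ρ ↦ Tρ`; `towerMap` iterates the block maps), producing effective densities level by level; here the `K' − N_W` old integrations of run `X` are presented AT ONCE as one Radon–Nikodym density `oldDensity` on the
`K`-free window space (`perfDensity` of `T4AveragingDisintegration` §6a along `oldTr`) — a presentation of the same iterated
integral, not a claim about print's inductive estimates; the successive structure is recoverable inside `oldDensity` by `towerMap`'s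
definition.
(b) The old transport is TOTAL in `(K', N_W)` with the constant junk value `1` when `N_W > K'`; every field of `TermRepr` is
conditioned on `τ ∈ T K`, where `NW τ ≤ KX K` holds by hypothesis, so the junk branch is never exercised (`oldTr_of_le`).  The
alternatives were rejected on the record: a `K`-dependent window level `jW K τ := N_W − K_X` makes the two runs' window TYPES differ
(`cauchy_of_repr` needs one family); shifting every cutoff by a constant bakes an arbitrary origin into every type.  (c) Cutoffs are
literal: run B of the comparison at `K` has cutoff `K + 1` in every type (`F.P (K + 1)`), matching `cauchy_of_repr`'s `hZB`.

Upstream: `T4WindowLevelShift` v1 (pv07).  Consumers (by name, nothing of theirs edited): the seat inhabiting the two finest-level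
representations (o1) and the `hsw` / (o3) / (o4) suppliers, all reading `cauchy_of_finest`'s binders.
-/

noncomputable section

open MeasureTheory
open scoped NNReal ENNReal

namespace Literature.MathematicalPhysics.QuantumFieldTheory.Balaban1983to89.T4FinestToWindow

open T4Continuum T4LevelShift T4AveragingDisintegration T4WindowLevelShift T4LipschitzLedger T4FiniteEpsInhabited
  BlockAveraging ExpMeanLog
open T4IndicatorShell T4LipschitzCutoff T4WeightBudget T4HybridMatching T4CauchySum

/-! ## §1 Generic: taking out window factors; the performed step with hypotheses only where terms live -/

section Generic

variable {α β : Type*} [MeasurableSpace α] [MeasurableSpace β]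

/-- **TAKING OUT WHAT LIVES ON THE TARGET SPACE.**  For an integrable a.e. nonnegative weight `F`, a measurable transport `Tr` with
`ν.map Tr ≪ μ` (`μ` σ-finite) and a bounded measurable nonnegative `g` on the target: the performed density of the weight
`(g ∘ Tr) · F` is `g` times the performed density of `F`, `μ`-a.e.  (Both sides have the same integrals against bounded measurable
test functions by `integral_perfDensity_mul`; `ae_eq_of_forall_integral_mul_eq`.) [folklore] -/
theorem perfDensity_mul_comp_ae {ν : Measure β} {F : β → ℝ} (hF : Integrable F ν) (hF0 : 0 ≤ᵐ[ν] F) {Tr : β → α}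
    (hTr : Measurable Tr) {μ : Measure α} [SigmaFinite μ] (hac : ν.map Tr ≪ μ) {g : α → ℝ} (hg : Measurable g)
    (hg0 : ∀ a, 0 ≤ g a) (hgb : ∃ C : ℝ, ∀ a, |g a| ≤ C) :
    (fun a => (perfDensity ν (fun w => g (Tr w) * F w) Tr μ a : ℝ)) =ᵐ[μ]
      fun a => g a * (perfDensity ν F Tr μ a : ℝ) := by
  obtain ⟨C, hC⟩ := hgb
  have hgF : Integrable (fun w => g (Tr w) * F w) ν :=
    hF.bdd_mul (hg.comp hTr).aestronglyMeasurable (ae_of_all _ fun w => by rw [Real.norm_eq_abs]; exact hC (Tr w))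
  have hgF0 : 0 ≤ᵐ[ν] fun w => g (Tr w) * F w := hF0.mono fun w hw => mul_nonneg (hg0 _) hw
  refine ae_eq_of_forall_integral_mul_eq (integrable_perfDensity hgF hTr hac)
    ((integrable_perfDensity hF hTr hac).bdd_mul hg.aestronglyMeasurable
      (ae_of_all _ fun a => by rw [Real.norm_eq_abs]; exact hC a)) fun f hf _ => ?_
  calc ∫ a, (perfDensity ν (fun w => g (Tr w) * F w) Tr μ a : ℝ) * f a ∂μ
      = ∫ a, f a * (perfDensity ν (fun w => g (Tr w) * F w) Tr μ a : ℝ) ∂μ := by simp_rw [mul_comm]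
    _ = ∫ w, f (Tr w) * (g (Tr w) * F w) ∂ν := integral_perfDensity_mul hgF hgF0 hTr hac hf
    _ = ∫ w, (f (Tr w) * g (Tr w)) * F w ∂ν := by simp_rw [mul_assoc]
    _ = ∫ a, (f a * g a) * (perfDensity ν F Tr μ a : ℝ) ∂μ := (integral_perfDensity_mul hF hF0 hTr hac (hf.mul hg)).symm
    _ = ∫ a, (g a * (perfDensity ν F Tr μ a : ℝ)) * f a ∂μ := by
        refine integral_congr_ae (ae_of_all _ fun a => ?_); simp only; ring

end Generic

section PerformedMem

variable {ι : Type*} {Ω Ωf : ℕ → ι → Type*} [∀ K τ, MeasurableSpace (Ω K τ)] [∀ K τ, MeasurableSpace (Ωf K τ)]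
  {l₀ : ℝ} {T : ℕ → Finset ι} {X : ℕ → ℝ → ι → ℝ} {χ : ℕ → ℝ → ℝ} {κ Lχ : ℕ → ℝ} {N₀ : ℕ} {n : ℕ → ℕ}
  {m : ℕ → ι → ℕ} {slot : ℕ → ι → ℕ → Σ _ : ℕ, ℕ} {pol : ℕ → ι → ℕ → Pol} {θ : ℕ → ι → ℕ → ℝ}
  {uX uY : (K : ℕ) → (τ : ι) → ℕ → Ω K τ → ℝ} {F : (K : ℕ) → ℝ → (τ : ι) → Ωf K τ → ℝ}

/-- **§6b WITH HYPOTHESES ONLY WHERE TERMS LIVE.**  As `T4AveragingDisintegration.termRepr_performed`, but the measurability of the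
transport `Tr K τ` and the domination `(ν K τ).map (Tr K τ) ≪ μ K τ` are demanded only for `τ ∈ T K` — every field of `TermRepr` is
conditioned on `τ ∈ T K`, so nothing more is ever used.  (Needed because the old transport of §2 below is dominated only in the regime
`N_W(τ) ≤ K_X`, which holds exactly for the terms of the `K`-th comparison.) [folklore] -/
theorem termRepr_performed_mem (ν : (K : ℕ) → (τ : ι) → Measure (Ωf K τ)) (μ : (K : ℕ) → (τ : ι) → Measure (Ω K τ))
    [∀ K τ, SigmaFinite (μ K τ)] (Tr : (K : ℕ) → (τ : ι) → Ωf K τ → Ω K τ) (hTr : ∀ K, ∀ τ ∈ T K, Measurable (Tr K τ))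
    (hac : ∀ K, ∀ τ ∈ T K, (ν K τ).map (Tr K τ) ≪ μ K τ)
    (hmeas : ∀ K, ∀ τ ∈ T K, ∀ i < m K τ, Measurable (uX K τ i) ∧ Measurable (uY K τ i))
    (h : TermRepr l₀ T X χ κ Lχ N₀ n ν m slot pol θ (fun K τ i w => uX K τ i (Tr K τ w))
      (fun K τ i w => uY K τ i (Tr K τ w)) F) :
    TermRepr l₀ T X χ κ Lχ N₀ n μ m slot pol θ uX uY
      (fun K t τ a => (perfDensity (ν K τ) (F K t τ) (Tr K τ) (μ K τ) a : ℝ)) where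
  profile := h.profile
  thr_pos := h.thr_pos
  slot_mem := h.slot_mem
  slot_band := h.slot_band
  meas := hmeas
  rem_nonneg K t ht τ hτ := ae_of_all _ fun a => NNReal.coe_nonneg _
  rem_int K t ht τ hτ := integrable_perfDensity (h.rem_int K t ht τ hτ) (hTr K τ hτ) (hac K τ hτ)
  repr K t ht τ hτ := by
    rw [h.repr K t ht τ hτ]
    exact (integral_perfDensity_mul (h.rem_int K t ht τ hτ) (h.rem_nonneg K t ht τ hτ) (hTr K τ hτ) (hac K τ hτ)
      (Finset.measurable_prod _ fun i hi =>
        measurable_facAt h.profile (hmeas K τ hτ i (Finset.mem_range.1 hi)).1)).symm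

end PerformedMem

section CongrVars

variable {ι : Type*} {Ω : ℕ → ι → Type*} [∀ K τ, MeasurableSpace (Ω K τ)]
  {l₀ : ℝ} {T : ℕ → Finset ι} {X : ℕ → ℝ → ι → ℝ} {χ : ℕ → ℝ → ℝ} {κ Lχ : ℕ → ℝ} {N₀ : ℕ} {n : ℕ → ℕ}
  {μ : (K : ℕ) → (τ : ι) → Measure (Ω K τ)} {m : ℕ → ι → ℕ} {slot : ℕ → ι → ℕ → Σ _ : ℕ, ℕ} {pol : ℕ → ι → ℕ → Pol}
  {θ : ℕ → ι → ℕ → ℝ} {uX uY uX' uY' : (K : ℕ) → (τ : ι) → ℕ → Ω K τ → ℝ} {RX : (K : ℕ) → ℝ → (τ : ι) → Ω K τ → ℝ}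

/-- **CHANGE OF TESTED VARIABLES BY POINTWISE IDENTITIES.**  A `TermRepr` is unchanged when each tested variable is replaced by a
pointwise-equal function (the slot factor `facAt … u i` reads `u i` only).  The (o1) supplier's tool: write the finest-level
representation with the run's natural finest-level functionals, then pass to the socket shape `uX K τ i ∘ oldTr` of §3 by the
recognition identities of §4. [folklore] -/
theorem termRepr_congr_vars (hX : ∀ K, ∀ τ ∈ T K, ∀ i < m K τ, ∀ v, uX K τ i v = uX' K τ i v)
    (hY : ∀ K, ∀ τ ∈ T K, ∀ i < m K τ, ∀ v, uY K τ i v = uY' K τ i v)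
    (h : TermRepr l₀ T X χ κ Lχ N₀ n μ m slot pol θ uX uY RX) :
    TermRepr l₀ T X χ κ Lχ N₀ n μ m slot pol θ uX' uY' RX where
  profile := h.profile
  thr_pos := h.thr_pos
  slot_mem := h.slot_mem
  slot_band := h.slot_band
  meas K τ hτ i hi := by
    have eX : uX' K τ i = uX K τ i := funext fun v => (hX K τ hτ i hi v).symm
    have eY : uY' K τ i = uY K τ i := funext fun v => (hY K τ hτ i hi v).symm
    rw [eX, eY]
    exact h.meas K τ hτ i hi
  rem_nonneg := h.rem_nonneg
  rem_int := h.rem_int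
  repr K t ht τ hτ := by
    rw [h.repr K t ht τ hτ]
    refine integral_congr_ae (ae_of_all _ fun v => ?_)
    simp only
    congr 1
    refine Finset.prod_congr rfl fun i hi => ?_
    simp only [facAt, hX K τ hτ i (Finset.mem_range.1 hi) v]

end CongrVars

/-! ## §2 The old transport of a run to a window, and the old density -/

section OldTransport

variable (F : T4Family) {G : Type*} [GaugeGroup G] (ℰ : LoopAverage G)

/-- Run `K'`'s level-indexed family of one-step block averagings with the small-loop average `ℰ`. -/
local notation "𝔸[" K' "]" => (fun j => (avgFun ℰ : GaugeField (F.P K') j G → GaugeField (F.P K') (j + 1) G))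

/-- **THE MODULUS FAMILY OF THE OLD TRANSPORT**: for `N_W ≤ K'`, level `0 + i` of the `N_W`-th run (= of the window record
`window (F.P K') N_W`, `T4WindowLevelShift.window_P`) and level `0 + (K' − N_W) + i` of the `K'`-th run have the same number of
sites per direction, for every `i` (`T4LevelShift.sitesPerDir_eq_of_shift`). [folklore] -/
theorem oldModulus {K' NW : ℕ} (h : NW ≤ K') (i : ℕ) :
    (F.P NW).sitesPerDir (0 + i) = (F.P K').sitesPerDir (0 + (K' - NW) + i) :=
  sitesPerDir_eq_of_shift F (by omega) i

/-- **THE OLD TRANSPORT** of the run with cutoff `K'` to the window of depth `N_W`: the `K' − N_W` OLD block-averaging steps from the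
finest level (`towerMap`), followed by the relabelling of run `K'`'s level `K' − N_W` onto level `0` of the `N_W`-th run's record
(`relabel ∘ bondShift` = `fieldShift`, `T4WindowLevelShift.relabel_bondShift`).  TOTAL in `(K', N_W)`: in the regime `N_W > K'`
(which no term of the `K`-th comparison occupies) its value is the constant configuration `1`. [folklore] -/
def oldTr (K' NW : ℕ) : GaugeField (F.P K') 0 G → GaugeField (F.P NW) 0 G := fun U =>
  if h : NW ≤ K' then relabel (bondShift (oldModulus F h 0)) (towerMap 𝔸[K'] 0 (K' - NW) U) else 1

/-- The old transport in the regime `N_W ≤ K'`, as a composite. [folklore] -/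
theorem oldTr_of_le {K' NW : ℕ} (h : NW ≤ K') :
    oldTr F ℰ K' NW = relabel (bondShift (oldModulus F h 0)) ∘ towerMap 𝔸[K'] 0 (K' - NW) := by
  funext U
  show oldTr F ℰ K' NW U = _
  unfold oldTr
  rw [dif_pos h]
  rfl

/-- The old transport in the regime `N_W ≤ K'`, pointwise. [folklore] -/
theorem oldTr_apply {K' NW : ℕ} (h : NW ≤ K') (U : GaugeField (F.P K') 0 G) :
    oldTr F ℰ K' NW U = relabel (bondShift (oldModulus F h 0)) (towerMap 𝔸[K'] 0 (K' - NW) U) := by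
  rw [oldTr_of_le F ℰ h]
  rfl

/-- The junk regime `K' < N_W`: the constant configuration. [folklore] -/
theorem oldTr_of_lt {K' NW : ℕ} (h : K' < NW) : oldTr F ℰ K' NW = fun _ => 1 := by
  funext U
  show oldTr F ℰ K' NW U = _
  unfold oldTr
  rw [dif_neg (Nat.not_le.2 h)]

omit [GaugeGroup G] in
/-- **SAME-RUN TRANSPORT OF TOWER MAPS ALONG AN EQUALITY OF STEP COUNTS** (both transports are identities,
`T4LevelShift.fieldShift_refl`). [folklore] -/
theorem towerMap_fieldShift_of_eq {K : ℕ} (avg : (j : ℕ) → GaugeField (F.P K) j G → GaugeField (F.P K) (j + 1) G) (lvl : ℕ)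
    {k k' : ℕ} (e : k = k') (hs : (F.P K).sitesPerDir (lvl + k) = (F.P K).sitesPerDir (lvl + k')) (U : GaugeField (F.P K) lvl G) :
    towerMap avg lvl k U = fieldShift hs (towerMap avg lvl k' U) := by
  subst e
  exact (fieldShift_refl _ _).symm

/-- **NO OLD STEPS**: when the window is the whole run (`N_W = K'`) the old transport is the identity. [folklore] -/
theorem oldTr_self (K' : ℕ) : oldTr F ℰ K' K' = id := by
  funext U
  have hs : (F.P K').sitesPerDir (0 + (K' - K')) = (F.P K').sitesPerDir (0 + 0) := by rw [Nat.sub_self]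
  rw [oldTr_apply F ℰ le_rfl, relabel_bondShift, towerMap_fieldShift_of_eq F _ 0 (Nat.sub_self K') hs U,
    fieldShift_fieldShift]
  exact fieldShift_refl _ _

variable [MeasurableSpace G]

/-- The old transport is measurable (when every one-step averaging is: `BlockAveraging.measurable_avgFun`). [folklore] -/
theorem measurable_oldTr [RegularGaugeGroup G] (hE : ∀ n, Measurable (fun W : Fin (n + 1) → G => ℰ.E W)) (K' NW : ℕ) :
    Measurable (oldTr F ℰ K' NW) := by
  by_cases h : NW ≤ K'
  · rw [oldTr_of_le F ℰ h]
    exact (measurable_relabel _).comp (measurable_towerMap _ (fun _ => measurable_avgFun ℰ hE) 0 _)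
  · rw [oldTr_of_lt F ℰ (Nat.not_le.1 h)]
    exact measurable_const

variable [HaarData G]

/-- **THE OLD DENSITY** `ρ^{old,X}_τ` of the run with cutoff `K'` on the window of depth `N_W`: the performed density
(`T4AveragingDisintegration.perfDensity`) of the run's finest-level weight `Fw` along the old transport, with respect to the window's
product Haar measure — the `K' − N_W` old integrations PERFORMED, as a VALUE on the window space. [folklore] -/
def oldDensity (K' NW : ℕ) (Fw : GaugeField (F.P K') 0 G → ℝ) : GaugeField (F.P NW) 0 G → ℝ≥0 :=
  perfDensity (fieldMeasure (F.P K') 0 G) Fw (oldTr F ℰ K' NW) (fieldMeasure (F.P NW) 0 G)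

/-- The old density is measurable. [folklore] -/
theorem measurable_oldDensity (K' NW : ℕ) (Fw : GaugeField (F.P K') 0 G → ℝ) : Measurable (oldDensity F ℰ K' NW Fw) :=
  measurable_perfDensity _ _ _ _

end OldTransport

section OldTransportSUN

variable {N : ℕ} [NeZero N] (F : T4Family)

/-- Bałaban's exp-mean-log small-plaquette average (0.4) on `SU(N)` (`ExpMeanLog.expMeanLogSU`). -/
local notation "EML" => (expMeanLogSU : LoopAverage (SU N))

/-- **`HaarAC` OF THE OLD TRANSPORT ON `SU(N)`** with Bałaban's exp-mean-log averaging at every old step, for `N_W ≤ K'`: the image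
of run `K'`'s finest-level product Haar measure is absolutely continuous with respect to the window's product Haar measure
(`towerAC_expMeanLogSU_SUN` along the old chain — always inside the standing range `0 + (K' − N_W) ≤ m + K'` —, then
`relabel_haarAC`; composed by `absolutelyContinuous_map_comp_of_map`). [folklore] -/
theorem oldTr_haarAC_SUN {K' NW : ℕ} (h : NW ≤ K') :
    (fieldMeasure (F.P K') 0 (SU N)).map (oldTr F EML K' NW) ≪ fieldMeasure (F.P NW) 0 (SU N) := by
  rw [oldTr_of_le F EML h]
  exact absolutelyContinuous_map_comp_of_map
    (measurable_towerMap _ (fun _ => measurable_avgFun _ measurable_expMeanLogSU_E) 0 _)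
    (towerAC_expMeanLogSU_SUN 0 (K' - NW) (by simp only [T4Family.P_m, T4Family.P_K]; omega))
    (measurable_relabel _) (relabel_haarAC _)

/-- Measurability of the old transport on `SU(N)` with exp-mean-log averaging (`ExpMeanLog.measurable_expMeanLogSU_E`). [folklore] -/
theorem measurable_oldTr_SUN (K' NW : ℕ) : Measurable (oldTr F EML K' NW) :=
  measurable_oldTr F EML measurable_expMeanLogSU_E K' NW

/-- **THE PUSH-FORWARD IDENTITY OF THE OLD DENSITY**: `∫ g · ρ^{old} dμ_W = ∫ (g ∘ oldTr) · Fw dU_{K'}` for measurable `g` on the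
window and an integrable a.e. nonnegative finest-level weight `Fw` (`integral_perfDensity_mul`). The change of variables the `hsw` /
(o4) suppliers use to move window integrals back to run `K'`'s finest level. [folklore] -/
theorem integral_oldDensity_mul {K' NW : ℕ} (h : NW ≤ K') {Fw : GaugeField (F.P K') 0 (SU N) → ℝ}
    (hF : Integrable Fw (fieldMeasure (F.P K') 0 (SU N))) (hF0 : 0 ≤ᵐ[fieldMeasure (F.P K') 0 (SU N)] Fw)
    {g : GaugeField (F.P NW) 0 (SU N) → ℝ} (hg : Measurable g) :
    ∫ V, g V * (oldDensity F EML K' NW Fw V : ℝ) ∂fieldMeasure (F.P NW) 0 (SU N) =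
      ∫ U, g (oldTr F EML K' NW U) * Fw U ∂fieldMeasure (F.P K') 0 (SU N) :=
  integral_perfDensity_mul hF hF0 (measurable_oldTr_SUN F K' NW) (oldTr_haarAC_SUN F h) hg

/-- **MASS**: the old density has the total mass of the weight. [folklore] -/
theorem integral_oldDensity {K' NW : ℕ} (h : NW ≤ K') {Fw : GaugeField (F.P K') 0 (SU N) → ℝ}
    (hF : Integrable Fw (fieldMeasure (F.P K') 0 (SU N))) (hF0 : 0 ≤ᵐ[fieldMeasure (F.P K') 0 (SU N)] Fw) :
    ∫ V, (oldDensity F EML K' NW Fw V : ℝ) ∂fieldMeasure (F.P NW) 0 (SU N) = ∫ U, Fw U ∂fieldMeasure (F.P K') 0 (SU N) := by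
  have h1 := integral_oldDensity_mul F h hF hF0 (g := fun _ => (1 : ℝ)) measurable_const
  simpa only [one_mul] using h1

/-- The old density of an integrable weight is integrable on the window. [folklore] -/
theorem integrable_oldDensity {K' NW : ℕ} (h : NW ≤ K') {Fw : GaugeField (F.P K') 0 (SU N) → ℝ}
    (hF : Integrable Fw (fieldMeasure (F.P K') 0 (SU N))) :
    Integrable (fun V => (oldDensity F EML K' NW Fw V : ℝ)) (fieldMeasure (F.P NW) 0 (SU N)) :=
  integrable_perfDensity hF (measurable_oldTr_SUN F K' NW) (oldTr_haarAC_SUN F h)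

/-- **THE REFEREE'S FACTORISATION `R^X_τ = [young factors] × ρ^{old,X}_τ`** (`t4/T4-REF-U5.md` §13.1) as an a.e. identity: a bounded
measurable nonnegative WINDOW factor `g` inside the finest-level weight (as `g ∘ oldTr`) comes out of the old density. [folklore] -/
theorem oldDensity_mul_comp_ae {K' NW : ℕ} (h : NW ≤ K') {Fw : GaugeField (F.P K') 0 (SU N) → ℝ}
    (hF : Integrable Fw (fieldMeasure (F.P K') 0 (SU N))) (hF0 : 0 ≤ᵐ[fieldMeasure (F.P K') 0 (SU N)] Fw)
    {g : GaugeField (F.P NW) 0 (SU N) → ℝ} (hg : Measurable g) (hg0 : ∀ V, 0 ≤ g V) (hgb : ∃ C : ℝ, ∀ V, |g V| ≤ C) :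
    (fun V => (oldDensity F EML K' NW (fun U => g (oldTr F EML K' NW U) * Fw U) V : ℝ)) =ᵐ[fieldMeasure (F.P NW) 0 (SU N)]
      fun V => g V * (oldDensity F EML K' NW Fw V : ℝ) :=
  perfDensity_mul_comp_ae hF hF0 (measurable_oldTr_SUN F K' NW) (oldTr_haarAC_SUN F h) hg hg0 hgb

/-- **NO OLD STEPS ⇒ THE OLD DENSITY IS THE WEIGHT**: when the window is the whole run (`N_W = K'`, `oldTr = id`) the old density of
an integrable a.e. nonnegative weight is the weight itself, a.e. — the window presentation degenerates correctly to the finest-level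
presentation. [folklore] -/
theorem oldDensity_self_ae (K' : ℕ) {Fw : GaugeField (F.P K') 0 (SU N) → ℝ}
    (hF : Integrable Fw (fieldMeasure (F.P K') 0 (SU N))) (hF0 : 0 ≤ᵐ[fieldMeasure (F.P K') 0 (SU N)] Fw) :
    (fun V => (oldDensity F EML K' K' Fw V : ℝ)) =ᵐ[fieldMeasure (F.P K') 0 (SU N)] Fw := by
  refine ae_eq_of_forall_integral_mul_eq (integrable_oldDensity F le_rfl hF) hF fun f hf _ => ?_
  have h1 := integral_oldDensity_mul F le_rfl hF hF0 hf
  rw [oldTr_self] at h1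
  calc ∫ V, (oldDensity F EML K' K' Fw V : ℝ) * f V ∂fieldMeasure (F.P K') 0 (SU N)
      = ∫ V, f V * (oldDensity F EML K' K' Fw V : ℝ) ∂fieldMeasure (F.P K') 0 (SU N) :=
        integral_congr_ae (ae_of_all _ fun V => mul_comm _ _)
    _ = ∫ U, f (id U) * Fw U ∂fieldMeasure (F.P K') 0 (SU N) := h1
    _ = ∫ U, Fw U * f U ∂fieldMeasure (F.P K') 0 (SU N) := integral_congr_ae (ae_of_all _ fun U => mul_comm _ _)

end OldTransportSUN

/-! ## §3 The socket theorem: a finest-level representation IS a window representation on the `K`-free window space -/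

section Socket

variable {ι : Type*} {N : ℕ} [NeZero N] (F : T4Family)
  {l₀ : ℝ} {T : ℕ → Finset ι} {X : ℕ → ℝ → ι → ℝ} {χ : ℕ → ℝ → ℝ} {κ Lχ : ℕ → ℝ} {N₀ : ℕ} {n : ℕ → ℕ}
  {m : ℕ → ι → ℕ} {slot : ℕ → ι → ℕ → Σ _ : ℕ, ℕ} {pol : ℕ → ι → ℕ → Pol} {θ : ℕ → ι → ℕ → ℝ}
  (NW : ι → ℕ) {uX uY : (K : ℕ) → (τ : ι) → ℕ → GaugeField (F.P (NW τ)) 0 (SU N) → ℝ}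

local notation "EML" => (expMeanLogSU : LoopAverage (SU N))

/-- The finest-level `meas` field from measurability ON THE WINDOW: window variables composed with the old transport are measurable on
run `KX K`'s finest level. [folklore] -/
theorem meas_comp_oldTr (KX : ℕ → ℕ)
    (hmeas : ∀ K, ∀ τ ∈ T K, ∀ i < m K τ, Measurable (uX K τ i) ∧ Measurable (uY K τ i)) :
    ∀ K, ∀ τ ∈ T K, ∀ i < m K τ, Measurable (fun U => uX K τ i (oldTr F EML (KX K) (NW τ) U)) ∧
      Measurable (fun U => uY K τ i (oldTr F EML (KX K) (NW τ) U)) := fun K τ hτ i hi =>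
  ⟨(hmeas K τ hτ i hi).1.comp (measurable_oldTr_SUN F (KX K) (NW τ)),
    (hmeas K τ hτ i hi).2.comp (measurable_oldTr_SUN F (KX K) (NW τ))⟩

/-- **THE SOCKET THEOREM.**  Run `X` with cutoff family `KX` (run A: `KX K = K`; run B: `KX K = K + 1`) and a `K`-FREE window depth
`NW : ι → ℕ` not deeper than the run on its terms (`hT`).  A finest-level representation of run `X`'s term weights — against run
`KX K`'s finest-level product Haar measure on `SU(N)`, with tested variables the WINDOW variables `uX K τ i`, `uY K τ i :
GaugeField (F.P (NW τ)) 0 (SU N) → ℝ` composed with the old transport `oldTr F EML (KX K) (NW τ)` (Bałaban's exp-mean-log averaging at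
every old step) and finest-level weight `FX K t τ` — IS a representation ON THE WINDOW: against the one `K`-independent reference
family `fun _ τ ↦ fieldMeasure (F.P (NW τ)) 0 (SU N)`, with the window variables themselves and the remainder the OLD DENSITY
`oldDensity F EML (KX K) (NW τ) (FX K t τ)`.  (`termRepr_performed_mem` with `oldTr_haarAC_SUN` on `τ ∈ T K`.) [folklore] -/
theorem termRepr_window_of_finest (KX : ℕ → ℕ) (hT : ∀ K, ∀ τ ∈ T K, NW τ ≤ KX K)
    (hmeas : ∀ K, ∀ τ ∈ T K, ∀ i < m K τ, Measurable (uX K τ i) ∧ Measurable (uY K τ i))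
    {FX : (K : ℕ) → ℝ → (τ : ι) → GaugeField (F.P (KX K)) 0 (SU N) → ℝ}
    (h : TermRepr l₀ T X χ κ Lχ N₀ n (fun K _ => fieldMeasure (F.P (KX K)) 0 (SU N)) m slot pol θ
      (fun K τ i U => uX K τ i (oldTr F EML (KX K) (NW τ) U)) (fun K τ i U => uY K τ i (oldTr F EML (KX K) (NW τ) U)) FX) :
    TermRepr l₀ T X χ κ Lχ N₀ n (fun _ τ => fieldMeasure (F.P (NW τ)) 0 (SU N)) m slot pol θ uX uY
      (fun K t τ V => (oldDensity F EML (KX K) (NW τ) (FX K t τ) V : ℝ)) :=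
  termRepr_performed_mem (Ω := fun _ τ => GaugeField (F.P (NW τ)) 0 (SU N))
    (Ωf := fun K _ => GaugeField (F.P (KX K)) 0 (SU N))
    (fun K _ => fieldMeasure (F.P (KX K)) 0 (SU N)) (fun _ τ => fieldMeasure (F.P (NW τ)) 0 (SU N))
    (fun K τ => oldTr F EML (KX K) (NW τ)) (fun K τ _ => measurable_oldTr_SUN F (KX K) (NW τ))
    (fun K τ hτ => oldTr_haarAC_SUN F (hT K τ hτ)) hmeas h

/-- **RUN A** (cutoff `K` at the `K`-th comparison). [folklore] -/
theorem termRepr_window_of_finest_A (hT : ∀ K, ∀ τ ∈ T K, NW τ ≤ K)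
    (hmeas : ∀ K, ∀ τ ∈ T K, ∀ i < m K τ, Measurable (uX K τ i) ∧ Measurable (uY K τ i))
    {FX : (K : ℕ) → ℝ → (τ : ι) → GaugeField (F.P K) 0 (SU N) → ℝ}
    (h : TermRepr l₀ T X χ κ Lχ N₀ n (fun K _ => fieldMeasure (F.P K) 0 (SU N)) m slot pol θ
      (fun K τ i U => uX K τ i (oldTr F EML K (NW τ) U)) (fun K τ i U => uY K τ i (oldTr F EML K (NW τ) U)) FX) :
    TermRepr l₀ T X χ κ Lχ N₀ n (fun _ τ => fieldMeasure (F.P (NW τ)) 0 (SU N)) m slot pol θ uX uY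
      (fun K t τ V => (oldDensity F EML K (NW τ) (FX K t τ) V : ℝ)) :=
  termRepr_window_of_finest F NW (fun K => K) hT hmeas h

/-- **RUN B** (cutoff `K + 1` at the `K`-th comparison — the LITERAL cutoff of `cauchy_of_repr`'s `hZB`). [folklore] -/
theorem termRepr_window_of_finest_B (hT : ∀ K, ∀ τ ∈ T K, NW τ ≤ K + 1)
    (hmeas : ∀ K, ∀ τ ∈ T K, ∀ i < m K τ, Measurable (uX K τ i) ∧ Measurable (uY K τ i))
    {FX : (K : ℕ) → ℝ → (τ : ι) → GaugeField (F.P (K + 1)) 0 (SU N) → ℝ}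
    (h : TermRepr l₀ T X χ κ Lχ N₀ n (fun K _ => fieldMeasure (F.P (K + 1)) 0 (SU N)) m slot pol θ
      (fun K τ i U => uX K τ i (oldTr F EML (K + 1) (NW τ) U)) (fun K τ i U => uY K τ i (oldTr F EML (K + 1) (NW τ) U)) FX) :
    TermRepr l₀ T X χ κ Lχ N₀ n (fun _ τ => fieldMeasure (F.P (NW τ)) 0 (SU N)) m slot pol θ uX uY
      (fun K t τ V => (oldDensity F EML (K + 1) (NW τ) (FX K t τ) V : ℝ)) :=
  termRepr_window_of_finest F NW (fun K => K + 1) hT hmeas h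

/-- **THE SOCKET THEOREM FROM NATURAL FINEST-LEVEL VARIABLES.**  The same, for a finest-level representation written with ANY
finest-level tested functionals `gX K τ i`, `gY K τ i : GaugeField (F.P (KX K)) 0 (SU N) → ℝ` that AGREE pointwise on the terms with
the window variables along the old transport (`hX`, `hY` — supplied by §4's `young_slot_eq_age` for slot variables that are
functionals of the run's own block averages) (`termRepr_congr_vars`, then `termRepr_window_of_finest`). [folklore] -/
theorem termRepr_window_of_finest_of_eq (KX : ℕ → ℕ) (hT : ∀ K, ∀ τ ∈ T K, NW τ ≤ KX K)
    (hmeas : ∀ K, ∀ τ ∈ T K, ∀ i < m K τ, Measurable (uX K τ i) ∧ Measurable (uY K τ i))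
    {gX gY : (K : ℕ) → (τ : ι) → ℕ → GaugeField (F.P (KX K)) 0 (SU N) → ℝ}
    (hX : ∀ K, ∀ τ ∈ T K, ∀ i < m K τ, ∀ U, uX K τ i (oldTr F EML (KX K) (NW τ) U) = gX K τ i U)
    (hY : ∀ K, ∀ τ ∈ T K, ∀ i < m K τ, ∀ U, uY K τ i (oldTr F EML (KX K) (NW τ) U) = gY K τ i U)
    {FX : (K : ℕ) → ℝ → (τ : ι) → GaugeField (F.P (KX K)) 0 (SU N) → ℝ}
    (h : TermRepr l₀ T X χ κ Lχ N₀ n (fun K _ => fieldMeasure (F.P (KX K)) 0 (SU N)) m slot pol θ gX gY FX) :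
    TermRepr l₀ T X χ κ Lχ N₀ n (fun _ τ => fieldMeasure (F.P (NW τ)) 0 (SU N)) m slot pol θ uX uY
      (fun K t τ V => (oldDensity F EML (KX K) (NW τ) (FX K t τ) V : ℝ)) :=
  termRepr_window_of_finest F NW KX hT hmeas
    (termRepr_congr_vars (fun K τ hτ i hi U => (hX K τ hτ i hi U).symm) (fun K τ hτ i hi U => (hY K τ hτ i hi U).symm) h)

end Socket

/-! ## §4 Recognition: the young slot variables along the old transport are the run's own averages -/

section Young

variable (F : T4Family) {G : Type*} [GaugeGroup G] (ℰ : LoopAverage G)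

local notation "𝔸[" K' "]" => (fun j => (avgFun ℰ : GaugeField (F.P K') j G → GaugeField (F.P K') (j + 1) G))

/-- **FURTHER AVERAGES OF THE OLD TRANSPORT**: for `N_W ≤ K'`, the window's `k₂`-fold block averages of `oldTr U` are run `K'`'s
OWN `(K' − N_W + k₂)`-fold averages of its finest field `U`, relabelled onto the window at level `0 + k₂`
(`T4WindowLevelShift.towerMap_relabel_towerMap` BY NAME). [folklore] -/
theorem towerMap_oldTr {K' NW : ℕ} (h : NW ≤ K') (k₂ : ℕ) (U : GaugeField (F.P K') 0 G) :
    towerMap 𝔸[NW] 0 k₂ (oldTr F ℰ K' NW U) =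
      relabel (bondShift ((oldModulus F h k₂).trans (sitesPerDir_assoc F K' 0 (K' - NW) k₂)))
        (towerMap 𝔸[K'] 0 (K' - NW + k₂) U) := by
  rw [oldTr_apply F ℰ h]
  exact towerMap_relabel_towerMap ℰ (oldModulus F h) k₂ U

/-- **A YOUNG SLOT VARIABLE ALONG THE OLD TRANSPORT**: any functional `f` of the window's `k₂`-fold averages (a plaquette variable of
a further average, …), evaluated on `oldTr U`, is the same functional of run `K'`'s own `(K' − N_W + k₂)`-fold averages of `U`, read
through the relabelling. [folklore] -/
theorem young_slot_eq {β : Sort*} {K' NW : ℕ} (h : NW ≤ K') (k₂ : ℕ) (f : GaugeField (F.P NW) (0 + k₂) G → β)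
    (U : GaugeField (F.P K') 0 G) :
    f (towerMap 𝔸[NW] 0 k₂ (oldTr F ℰ K' NW U)) =
      f (relabel (bondShift ((oldModulus F h k₂).trans (sitesPerDir_assoc F K' 0 (K' - NW) k₂)))
        (towerMap 𝔸[K'] 0 (K' - NW + k₂) U)) := by
  rw [towerMap_oldTr F ℰ h]

/-- **THE MODULUS OF A YOUNG LEVEL**: for `a ≤ N_W ≤ K'`, level `N_W − a` of the `N_W`-th run (age `a` on the window) and level
`K' − a` of the `K'`-th run (age `a` in run `K'`) have the same number of sites per direction. [folklore] -/
theorem youngModulus {K' NW a : ℕ} (h : NW ≤ K') (ha : a ≤ NW) :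
    (F.P NW).sitesPerDir (0 + (NW - a)) = (F.P K').sitesPerDir (0 + (K' - a)) := by
  simp only [Params.sitesPerDir, T4Family.P_L, T4Family.P_m, T4Family.P_K]
  congr 1
  congr 1
  omega

/-- **THE AGE FORM** (the (o1) supplier's rewriting lemma): a young slot variable of AGE `a ≤ N_W`, typed on the window as a
functional `f` of the `(N_W − a)`-fold window average, equals along the old transport of run `K'` (`N_W ≤ K'`) the same `f` of run
`K'`'s OWN `(K' − a)`-fold average of its finest field — the field of age `a` in run `K'` —, read through the level identification
`fieldShift (youngModulus F h ha)`. [folklore] -/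
theorem young_slot_eq_age {β : Sort*} {K' NW a : ℕ} (h : NW ≤ K') (ha : a ≤ NW)
    (f : GaugeField (F.P NW) (0 + (NW - a)) G → β) (U : GaugeField (F.P K') 0 G) :
    f (towerMap 𝔸[NW] 0 (NW - a) (oldTr F ℰ K' NW U)) =
      f (fieldShift (youngModulus F h ha) (towerMap 𝔸[K'] 0 (K' - a) U)) := by
  have e : K' - NW + (NW - a) = K' - a := by omega
  have hs : (F.P K').sitesPerDir (0 + (K' - NW + (NW - a))) = (F.P K').sitesPerDir (0 + (K' - a)) := by rw [e]
  rw [towerMap_oldTr F ℰ h (NW - a) U, relabel_bondShift, towerMap_fieldShift_of_eq F _ 0 e hs U, fieldShift_fieldShift]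

end Young

/-! ## §5 End-to-end: `cauchy_of_repr` from the two finest-level representations -/

section TwoRuns

variable {ι : Type*} [DecidableEq ι] {N : ℕ} [NeZero N] (F : T4Family)
  {l₀ vol : ℝ} {T : ℕ → Finset ι} {A B : ℕ → ℝ → ι → ℝ} {χ : ℕ → ℝ → ℝ} {κ Lχ : ℕ → ℝ} {N₀ : ℕ} {n : ℕ → ℕ}
  {m : ℕ → ι → ℕ} {slot : ℕ → ι → ℕ → Σ _ : ℕ, ℕ} {pol : ℕ → ι → ℕ → Pol} {θ : ℕ → ι → ℕ → ℝ}
  (NW : ι → ℕ) {uA uB : (K : ℕ) → (τ : ι) → ℕ → GaugeField (F.P (NW τ)) 0 (SU N) → ℝ}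
  {ρ S W δ : ℕ → ℝ} {Bad : ℕ → ℝ → Finset ι}

local notation "EML" => (expMeanLogSU : LoopAverage (SU N))

/-- **THE η-DESIGN END-TO-END FROM THE FINEST LEVEL** (`T4LipschitzLedger.cauchy_of_repr` with its binders `hA`, `hB` replaced by
the two FINEST-LEVEL representations, discharged onto the common `K`-free window family by `termRepr_window_of_finest_A/_B`).
Inputs, all BINDERS (nothing of Bałaban's asserted): the window depth `NW` with `hT : NW τ ≤ K` on `T K`; run A's representation
against `fieldMeasure (F.P K) 0 (SU N)` and run B's against `fieldMeasure (F.P (K + 1)) 0 (SU N)` — tested variables the window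
functionals `uA`, `uB` along the respective old transports, finest-level weights `FA`, `FB` —; measurability of `uA`, `uB` on the
window; and `cauchy_of_repr`'s remaining binders VERBATIM on the window reference `fun _ τ ↦ fieldMeasure (F.P (NW τ)) 0 (SU N)` with
the remainders `oldDensity F EML K (NW τ) (FA K t τ)` / `oldDensity F EML (K + 1) (NW τ) (FB K t τ)` (`SupClose`, sibling
suppression in both runs, the weight condition, the term sums, positivity, summable `δ`, node U5b's factor ledger `hsw`).
Output: `cauchy_of_repr`'s conclusion (matching modulo constants with the hybrid rate, its summability, the Cauchy property and
uniform convergence of the normalised generating functions on `|t| ≤ l₀`). [folklore] -/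
theorem cauchy_of_finest {Z : ℕ → ℝ → ℝ} (hvol : 0 < vol) (hl₀ : 0 ≤ l₀)
    (hW : RelWeightBound l₀ T A B Bad W)
    (hT : ∀ K, ∀ τ ∈ T K, NW τ ≤ K)
    (hmeas : ∀ K, ∀ τ ∈ T K, ∀ i < m K τ, Measurable (uA K τ i) ∧ Measurable (uB K τ i))
    {FA : (K : ℕ) → ℝ → (τ : ι) → GaugeField (F.P K) 0 (SU N) → ℝ}
    {FB : (K : ℕ) → ℝ → (τ : ι) → GaugeField (F.P (K + 1)) 0 (SU N) → ℝ}
    (hA : TermRepr l₀ T A χ κ Lχ N₀ n (fun K _ => fieldMeasure (F.P K) 0 (SU N)) m slot pol θ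
      (fun K τ i U => uA K τ i (oldTr F EML K (NW τ) U)) (fun K τ i U => uB K τ i (oldTr F EML K (NW τ) U)) FA)
    (hB : TermRepr l₀ T B χ κ Lχ N₀ n (fun K _ => fieldMeasure (F.P (K + 1)) 0 (SU N)) m slot pol θ
      (fun K τ i U => uB K τ i (oldTr F EML (K + 1) (NW τ) U)) (fun K τ i U => uA K τ i (oldTr F EML (K + 1) (NW τ) U)) FB)
    (hF : SupClose T (fun _ τ => fieldMeasure (F.P (NW τ)) 0 (SU N)) m slot θ uA uB ρ)
    (hSA : SiblingSuppression l₀ T A N₀ n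
      (sibW χ κ (fun _ τ => fieldMeasure (F.P (NW τ)) 0 (SU N)) m slot pol θ uA
        (fun K t τ V => (oldDensity F EML K (NW τ) (FA K t τ) V : ℝ)) ρ) S)
    (hSB : SiblingSuppression l₀ T B N₀ n
      (sibW χ κ (fun _ τ => fieldMeasure (F.P (NW τ)) 0 (SU N)) m slot pol θ uB
        (fun K t τ V => (oldDensity F EML (K + 1) (NW τ) (FB K t τ) V : ℝ)) ρ) S)
    (hS : ∀ a ≤ N₀, 0 ≤ S a) (hρ0 : ∀ j, 0 ≤ ρ j) (hρ : Summable ρ)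
    (hlt : ∀ K, W K + ∑ a ∈ Finset.range (N₀ + 1), (n a : ℝ) * lipWeight Lχ S ρ a K < 1)
    (hZA : ∀ K t, |t| ≤ l₀ → Z K t = ∑ τ ∈ T K, A K t τ)
    (hZB : ∀ K t, |t| ≤ l₀ → Z (K + 1) t = ∑ τ ∈ T K, B K t τ)
    (hpos : ∀ K t, |t| ≤ l₀ → 0 < ∑ τ ∈ T K, A K t τ) (hδ : Summable δ) {c : ℕ → ℝ}
    (hsw : ∀ K t, |t| ≤ l₀ → ∀ τ ∈ T K \ Bad K t,
      (∀ᵐ V ∂(fieldMeasure (F.P (NW τ)) 0 (SU N)),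
          Real.exp (c K - vol * δ K) * (oldDensity F EML K (NW τ) (FA K t τ) V : ℝ) ≤
            (oldDensity F EML (K + 1) (NW τ) (FB K t τ) V : ℝ)) ∧
        (∀ᵐ V ∂(fieldMeasure (F.P (NW τ)) 0 (SU N)),
          (oldDensity F EML (K + 1) (NW τ) (FB K t τ) V : ℝ) ≤
            Real.exp (c K + vol * δ K) * (oldDensity F EML K (NW τ) (FA K t τ) V : ℝ))) :
    MatchingModConstants vol l₀
        (hybridDelta vol δ (fun K => W K + ∑ a ∈ Finset.range (N₀ + 1), (n a : ℝ) * lipWeight Lχ S ρ a K)) Z ∧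
      Summable (hybridDelta vol δ (fun K => W K + ∑ a ∈ Finset.range (N₀ + 1), (n a : ℝ) * lipWeight Lχ S ρ a K)) ∧
      (∀ t : ℝ, |t| ≤ l₀ → CauchySeq fun K => genFun Z K t) ∧
      TendstoUniformlyOn (fun K t => genFun Z K t) (genFunLim Z) Filter.atTop {t | |t| ≤ l₀} :=
  cauchy_of_repr hvol hl₀ hW (termRepr_window_of_finest_A F NW hT hmeas hA)
    (termRepr_window_of_finest_B F NW (fun K τ hτ => Nat.le_succ_of_le (hT K τ hτ))
      (fun K τ hτ i hi => (hmeas K τ hτ i hi).symm) hB)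
    hF hSA hSB hS hρ0 hρ hlt hZA hZB hpos hδ hsw

end TwoRuns

/-! ## §6 SANITY on a concrete family (`L = 13`, `m = 1`): the transport and the recognition identities fire with numerals -/

namespace Sanity

open T4WindowLevelShift.Sanity (F13)

variable {G : Type*} [GaugeGroup G] (ℰ : LoopAverage G)

/-- The old transport of run `9` to the window of depth `2`: SEVEN old block-averaging steps from the finest level, then the level
shift `(run 2, level 0) ≃ (run 9, level 7)`. -/
example : oldTr F13 ℰ 9 2 =
    relabel (bondShift (oldModulus F13 (show 2 ≤ 9 by decide) 0)) ∘
      towerMap (fun j => (avgFun ℰ : GaugeField (F13.P 9) j G → GaugeField (F13.P 9) (j + 1) G)) 0 7 :=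
  oldTr_of_le F13 ℰ (show 2 ≤ 9 by decide)

/-- No old steps: the window of depth `5` of run `5` is the run itself. -/
example : oldTr F13 ℰ 5 5 = id := oldTr_self F13 ℰ 5

/-- The numerology of a young level: age `1` is level `1` of run `2` and level `8` of run `9`, both with `2·13²` sites per direction. -/
example : (F13.P 2).sitesPerDir 1 = 2 * 13 ^ 2 ∧ (F13.P 9).sitesPerDir 8 = 2 * 13 ^ 2 := by
  simp only [Params.sitesPerDir, T4Family.P_L, T4Family.P_m, T4Family.P_K]
  show 2 * 13 ^ (1 + 2 - 1) = 2 * 13 ^ 2 ∧ 2 * 13 ^ (1 + 9 - 8) = 2 * 13 ^ 2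
  norm_num

/-- The age form with numerals: a slot variable of age `1` on the window of depth `2` (a functional `f` of ONE window average),
evaluated along the old transport of run `9`, is `f` of run `9`'s own EIGHT-fold average of its finest field, level-shifted. -/
example (f : GaugeField (F13.P 2) (0 + 1) G → ℝ) (U : GaugeField (F13.P 9) 0 G) :
    f (towerMap (fun j => (avgFun ℰ : GaugeField (F13.P 2) j G → GaugeField (F13.P 2) (j + 1) G)) 0 1 (oldTr F13 ℰ 9 2 U)) =
      f (fieldShift (youngModulus F13 (show 2 ≤ 9 by decide) (show 1 ≤ 2 by decide))
        (towerMap (fun j => (avgFun ℰ : GaugeField (F13.P 9) j G → GaugeField (F13.P 9) (j + 1) G)) 0 8 U)) :=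
  young_slot_eq_age F13 ℰ (show 2 ≤ 9 by decide) (show 1 ≤ 2 by decide) f U

/-- The oldest window level (age `2` = `N_W`): the window's finest field itself along the transport is run `9`'s SEVEN-fold
average, level-shifted (`k₂ = 0` further steps). -/
example (f : GaugeField (F13.P 2) (0 + 0) G → ℝ) (U : GaugeField (F13.P 9) 0 G) :
    f (towerMap (fun j => (avgFun ℰ : GaugeField (F13.P 2) j G → GaugeField (F13.P 2) (j + 1) G)) 0 0 (oldTr F13 ℰ 9 2 U)) =
      f (fieldShift (youngModulus F13 (show 2 ≤ 9 by decide) (show 2 ≤ 2 by decide))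
        (towerMap (fun j => (avgFun ℰ : GaugeField (F13.P 9) j G → GaugeField (F13.P 9) (j + 1) G)) 0 7 U)) :=
  young_slot_eq_age F13 ℰ (show 2 ≤ 9 by decide) (show 2 ≤ 2 by decide) f U

end Sanity

end Literature.MathematicalPhysics.QuantumFieldTheory.Balaban1983to89.T4FinestToWindow

end
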